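import Literature.AlgebraicGeometry.Crystalline.DeRhamComplexHodgeSheaves
import Literature.AlgebraicGeometry.Crystalline.SheafHypercohomology
import Literature.AlgebraicGeometry.Motives.WittSchemePrimeToP
import Literature.Algebra.Homology.HyperExtSingle
import Literature.Algebra.Homology.StupidFiltrationDegeneration
import HarnessLib

/-!
# The single columns `Ωʲ[-j]` of the de Rham complex have torsion-free hyper-Ext under the
# hypotheses of the `p`-adic lifting crux

The stupid-filtration machinery of `Literature.Algebra.Homology.StupidFiltrationDegeneration`
(rational ⇒ integral `E₁`-degeneration, torsion-freeness and surjectivity along `σ≤n K`) takes its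
hypotheses on the SINGLE COLUMNS `Kⁿ[-n] = (CochainComplex.singleFunctor _ n).obj (K.X n)` of a
`ℤ`-indexed complex `K`, in the form

  `∀ (n k m : ℤ), m ≠ 0 → ∀ x : HyperExt A Kⁿ[-n] k, m • x = 0 → x = 0`.

For `K = Ω•_{𝒳/W}` (the `ℤ`-extension of `Crystalline.algebraicDeRhamComplex 𝒳`, the complex of the
named fact `Crystalline.HodgeDeRhamDegeneratesModTorsion` and of the Hu complexes) and `A = ℤ`, this
file DISCHARGES that hypothesis from the hypotheses of crux P1a `FormalLiftingFromClassLifting` of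
route `HodgeConjecture/PadicSemiregularLift` — `Hᵇ(𝒳, 𝒪)` and `Hᵇ(𝒳, Ω¹)` have no `p`-torsion for all
`b`, and `d ≤ 3 ∨ Ω¹_{𝒳/W} ≅ 𝒪^d` — in every column `n` the hypotheses reach (`n ≤ 1` always; all
`n` when `3 < d`), and for EVERY non-zero integer `m` (integers prime to `p` act invertibly,
`Motives/WittSchemePrimeToP`):

* `torsionFree_hyperExt_single_extend` — abstract: for an `ℕ`-complex `L` in an abelian category,
  if `Extᵇ(A, Lʲ)` has no `m`-torsion for the `j` in a down-closed range then
  `HyperExt A Kⁿ[-n] k` (`K = L` extended by zero to `ℤ`) has no `m`-torsion for `n` in the range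
  (`HyperExt A Kⁿ[-n] k = Ext^{k-n}(A, Kⁿ)`, `Algebra/Homology/HyperExtSingle`; negative `n` and
  `k < n` are free);
* `torsionFree_hyperExt_single_deRham` — `k`-scheme `X`: `m`-torsion-freeness of the Hodge
  cohomology `Hᵇ(X, (Ω•)ʲ)` (`Sheaf.H`) for `j` in a range gives it for the hyper-Ext of the columns;
* `torsionFree_H_algebraicDeRhamComplex_X_of_pTorsionFree` — `W(k)`-scheme: "no `p`-torsion ⇒ no
  torsion" for `Hᵇ(𝒳, (Ω•)ʲ)` (through `(Ω•)ʲ ≅ Ωʲ = ⋀ʲΩ¹`, `Crystalline/DeRhamComplexHodgeSheaves`, and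
  `WittScheme.eq_zero_of_zsmul_eq_zero_of_pTorsionFree`);
* **`torsionFree_hyperExt_single_deRham_of_hypotheses`** — the crux-shaped statement: under `hO`,
  `hΩ`, `hdisj` as typed in the crux, for `m ≠ 0` and `n ≤ 1 ∨ 3 < d`, `HyperExt ℤ (Ω•)ⁿ[-n] k` has
  no `m`-torsion.

[folklore] Everything is proved; no named facts (the crux's hypotheses enter as hypotheses).
Sources for the role of these groups: S. Bloch, H. Esnault, M. Kerz, Invent. Math. 195 (2014),
Rem. 35; X. Hu, arXiv:2507.12458, §11.
-/

noncomputable section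

open CategoryTheory Opposite TopologicalSpace

universe w v u

namespace Literature.Algebra.Homology

/-! ### Abstract: columns of an extended `ℕ`-complex -/

section Abstract

variable {C : Type u} [Category.{v} C] [Abelian C] [HasExt.{w} C] (A : C)
  [hA : ∀ (n : ℤ) (Y : C), HasHyperExt.{w} A ((CochainComplex.singleFunctor C n).obj Y)]
  (L : CochainComplex C ℕ)

omit hA in
/-- An `Ext` class with values in a zero object is zero. [folklore] -/
theorem Ext.eq_zero_of_isZero {Y : C} (hY : Limits.IsZero Y) {b : ℕ} (y : Abelian.Ext.{w} A Y b) :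
    y = 0 := by
  rw [← Abelian.Ext.comp_mk₀_id y, hY.eq_of_src (𝟙 Y) 0, Abelian.Ext.mk₀_zero,
    Abelian.Ext.comp_zero]

/-- **Columns of an extended complex.** Let `K` be the extension by zero to `ℤ` of an `ℕ`-indexed
cochain complex `L` (Mathlib's `HomologicalComplex.extend` along `ComplexShape.embeddingUpNat`) and
`P` a condition on (column, total degree). If `Extᵇ(A, Lʲ)` has no `m`-torsion whenever
`P j (j + b)`, then `HyperExt A Kⁿ[-n] k` has no `m`-torsion whenever `P n k`: for `k < n` the
group is zero, for `n < 0` the column is zero, and otherwise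
`HyperExt A Kⁿ[-n] k ≃+ Ext^{k-n}(A, Lⁿ)` (`HyperExt.singleEquiv`, `HomologicalComplex.extendXIso`).
[folklore] -/
theorem torsionFree_hyperExt_single_extend (P : ℤ → ℤ → Prop) (m : ℤ)
    (htf : ∀ (j b : ℕ), P j ((j : ℤ) + b) → ∀ y : Abelian.Ext.{w} A (L.X j) b, m • y = 0 → y = 0)
    (n k : ℤ) (hn : P n k)
    (x : HyperExt.{w} A ((CochainComplex.singleFunctor C n).obj
      ((L.extend ComplexShape.embeddingUpNat).X n)) k)
    (hx : m • x = 0) : x = 0 := by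
  by_cases hkn : k < n
  · exact HyperExt.eq_zero_single_of_lt _ n k hkn x
  obtain ⟨b, hb⟩ : ∃ b : ℕ, n + b = k := ⟨(k - n).toNat, by omega⟩
  revert x
  rw [HyperExt.torsionFree_single_iff _ n b k hb m]
  intro y hy
  by_cases hn0 : n < 0
  · exact Ext.eq_zero_of_isZero A
      (L.isZero_extend_X ComplexShape.embeddingUpNat n fun j => by
        change (j : ℤ) ≠ n; omega) y
  obtain ⟨j, rfl⟩ : ∃ j : ℕ, (j : ℤ) = n := ⟨n.toNat, by omega⟩
  have e : (L.extend ComplexShape.embeddingUpNat).X (j : ℤ) ≅ L.X j :=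
    L.extendXIso ComplexShape.embeddingUpNat rfl
  subst hb
  exact Ext.torsionFree_of_iso e.symm (htf j b hn) y hy

end Abstract

end Literature.Algebra.Homology

namespace Literature.AlgebraicGeometry.Crystalline

open _root_.AlgebraicGeometry Literature.AlgebraicGeometry.Motives Literature.Algebra.Homology

-- `HasHyperExt` for single complexes of sheaves is found through `IsStrictlyGE n ⇒ IsGE`; the
-- columns of the de Rham complex need a slightly larger budget than the default.
set_option synthInstance.maxHeartbeats 200000

/-! ### `k`-schemes: columns of the de Rham complex -/

section Scheme

variable {k : Type u} [CommRing k] (X : Over (Spec (CommRingCat.of k)))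

/-- **Torsion-free columns of `Ω•_{X/k}` from torsion-free Hodge cohomology.** Let `K` be the
`ℤ`-extended algebraic de Rham complex of the `k`-scheme `X` and `ℤ` the constant sheaf
(`Crystalline.constantSheafInt`, the coefficients of `Sheaf.H` and of `SheafHypercohomology`). If,
whenever `P j (j + b)`, the Hodge cohomology group `Hᵇ(X, (Ω•)ʲ)` (`Sheaf.H` of the de Rham term;
equivalently `Motives.hodgeCohomology X j b`, `Crystalline/DeRhamComplexHodgeSheaves`) has no
`m`-torsion, then neither has `HyperExt ℤ Kⁿ[-n] k` whenever `P n k`. [folklore] -/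
theorem torsionFree_hyperExt_single_deRham
    [hA : ∀ (n : ℤ) (Y : Sheaf (Opens.grothendieckTopology X.left) AddCommGrpCat.{u}),
      HasHyperExt.{u} (constantSheafInt (Opens.grothendieckTopology X.left))
        ((CochainComplex.singleFunctor _ n).obj Y)]
    (P : ℤ → ℤ → Prop) (m : ℤ)
    (htf : ∀ (j b : ℕ), P j ((j : ℤ) + b) →
      ∀ y : ((algebraicDeRhamComplex X).X j).H b, m • y = 0 → y = 0)
    (n k : ℤ) (hn : P n k)
    (x : HyperExt.{u} (constantSheafInt (Opens.grothendieckTopology X.left))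
      ((CochainComplex.singleFunctor _ n).obj
        (((algebraicDeRhamComplex X).extend ComplexShape.embeddingUpNat).X n)) k)
    (hx : m • x = 0) : x = 0 :=
  torsionFree_hyperExt_single_extend _ (algebraicDeRhamComplex X) P m htf n k hn x hx

/-- **Grothendieck vanishing for the de Rham terms**: on a noetherian `k`-scheme `X` of (topological
Krull) dimension `< b`, `Hᵇ(X, (Ω•)ᵃ) = 0` for every `a` (transport along `(Ω•)ᵃ ≅ Ωᵃ`,
`Crystalline.hAddEquiv`, of the tree's `Motives.subsingleton_hodgeCohomology_of_lt`, Hartshorne III.2.7).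
[cite: Hartshorne1977, III Thm. 2.7] -/
theorem subsingleton_H_algebraicDeRhamComplex_X_of_lt [AlgebraicGeometry.IsNoetherian X.left] (a b : ℕ)
    (hb : topologicalKrullDim X.left < b) : Subsingleton (((algebraicDeRhamComplex X).X a).H b) := by
  have h : Subsingleton (hodgeCohomology X a b) := subsingleton_hodgeCohomology_of_lt X a b hb
  exact (hAddEquiv X a b).toEquiv.injective.subsingleton

/-- **Vanishing of the columns above the dimension**: on a noetherian `k`-scheme `X` of dimension
`< b₀`, `HyperExt ℤ (Ω•)ⁿ[-n] k = 0` whenever `n + b₀ ≤ k` (the group is `H^{k-n}(X, (Ω•)ⁿ)`, or zero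
for `k < n` / `n < 0`): vanishing is freeness of `0`-torsion, so this is the column argument with
`m = 0`. This is the (weak, `dim X`) bound used to truncate the hyper-Ext of the staircase
complexes; the sharp bound for `p`-torsion quotients (dimension of the special fibre) is not here.
[cite: Hartshorne1977, III Thm. 2.7] -/
theorem hyperExt_single_deRham_eq_zero_of_le [AlgebraicGeometry.IsNoetherian X.left]
    [hA : ∀ (n : ℤ) (Y : Sheaf (Opens.grothendieckTopology X.left) AddCommGrpCat.{u}),
      HasHyperExt.{u} (constantSheafInt (Opens.grothendieckTopology X.left))
        ((CochainComplex.singleFunctor _ n).obj Y)]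
    (b₀ : ℕ) (hb₀ : topologicalKrullDim X.left < b₀) (n k : ℤ) (hk : n + b₀ ≤ k)
    (x : HyperExt.{u} (constantSheafInt (Opens.grothendieckTopology X.left))
      ((CochainComplex.singleFunctor _ n).obj
        (((algebraicDeRhamComplex X).extend ComplexShape.embeddingUpNat).X n)) k) : x = 0 := by
  refine torsionFree_hyperExt_single_deRham X (fun n k => n + b₀ ≤ k) 0 (fun j b hjb y _ => ?_)
    n k hk x (zero_smul ℤ x)
  have hb : topologicalKrullDim X.left < b :=
    lt_of_lt_of_le hb₀ (by exact_mod_cast (show b₀ ≤ b by omega))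
  haveI := subsingleton_H_algebraicDeRhamComplex_X_of_lt X j b hb
  exact Subsingleton.elim _ _

end Scheme

/-! ### `W(k)`-schemes: no `p`-torsion is no torsion, and the hypotheses of the crux -/

section Witt

variable {p : ℕ} [Fact p.Prime] {k : Type} [Field k] [CharP k p]
  (𝒳 : SchemeOver (WittVector p k))

/-- **No `p`-torsion ⇒ no torsion for `Hᵇ(𝒳, (Ω•)ʲ)`** on a `W(k)`-scheme: integers prime to `p`
act bijectively on the cohomology of the `𝒪_𝒳`-module `Ωʲ = ⋀ʲΩ¹` (`WittScheme.zsmul_H_bijective`),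
to which the de Rham term is isomorphic (`algebraicDeRhamComplexXIso`). [folklore] -/
theorem torsionFree_H_algebraicDeRhamComplex_X_of_pTorsionFree (j b : ℕ)
    (htf : ∀ y : ((algebraicDeRhamComplex 𝒳).X j).H b, (p : ℤ) • y = 0 → y = 0)
    {m : ℤ} (hm : m ≠ 0) (y : ((algebraicDeRhamComplex 𝒳).X j).H b) (hy : m • y = 0) : y = 0 := by
  have htf' := (H_algebraicDeRhamComplex_X_torsionFree_iff 𝒳 j b (p : ℤ)).mp htf
  refine (Sheaf.H.torsionFree_iff_of_iso (n := b) (algebraicDeRhamComplexXIso 𝒳 j) (m := m)).mpr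
    (fun z hz => ?_) y hy
  exact WittScheme.eq_zero_of_zsmul_eq_zero_of_pTorsionFree 𝒳 (hodgeSheaf 𝒳 j) b htf' hm z hz

/-- **The single columns of `Ω•_{𝒳/W}` have torsion-free hyper-Ext under the hypotheses of the
crux `FormalLiftingFromClassLifting`** (route `HodgeConjecture/PadicSemiregularLift`): for a
`W(k)`-scheme `𝒳` with `Hᵇ(𝒳, 𝒪)` (`hO`) and `Hᵇ(𝒳, Ω¹)` (`hΩ`) free of `p`-torsion for all `b` and
`d ≤ 3 ∨ Ω¹_{𝒳/W} ≅ 𝒪^d` (`hdisj`), for every `m ≠ 0`, every `k` and every column `n` the hypotheses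
reach — `n ≤ 1`, or any `n` when `3 < d` (then all `(Ω•)ʲ ≅ 𝒪^{C(d,j)}`) — the group
`HyperExt ℤ (Ω•)ⁿ[-n] k = H^{k-n}(𝒳, (Ω•)ⁿ)` has no `m`-torsion. This is the hypothesis `htf` of
`stupidFiltration_delta_eq_zero` / `torsionFree_hyperExt_stupidTruncLE`
(`Algebra/Homology/StupidFiltrationDegeneration`) for the de Rham complex of `𝒳`, column by column.
[folklore] -/
theorem torsionFree_hyperExt_single_deRham_of_hypotheses
    [hA : ∀ (n : ℤ) (Y : Sheaf (Opens.grothendieckTopology 𝒳.left) AddCommGrpCat.{0}),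
      HasHyperExt.{0} (constantSheafInt (Opens.grothendieckTopology 𝒳.left))
        ((CochainComplex.singleFunctor _ n).obj Y)]
    {d : ℕ}
    (hO : ∀ (b : ℕ) (x : structureSheafCohomology 𝒳.left b), (p : ℤ) • x = 0 → x = 0)
    (hΩ : ∀ (b : ℕ) (x : hodgeCohomologyOne 𝒳 b), (p : ℤ) • x = 0 → x = 0)
    (hdisj : d ≤ 3 ∨ Nonempty (cotangentSheaf 𝒳 ≅
      SheafOfModules.free (R := 𝒳.left.ringCatSheaf) (Fin d)))
    {m : ℤ} (hm : m ≠ 0) (n k : ℤ) (hn : n ≤ 1 ∨ 3 < d)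
    (x : HyperExt.{0} (constantSheafInt (Opens.grothendieckTopology 𝒳.left))
      ((CochainComplex.singleFunctor _ n).obj
        (((algebraicDeRhamComplex 𝒳).extend ComplexShape.embeddingUpNat).X n)) k)
    (hx : m • x = 0) : x = 0 :=
  torsionFree_hyperExt_single_deRham 𝒳 (fun (n _ : ℤ) => n ≤ 1 ∨ 3 < d) m
    (fun j b hj => torsionFree_H_algebraicDeRhamComplex_X_of_pTorsionFree 𝒳 j b
      (H_algebraicDeRhamComplex_X_torsionFree_of_hypotheses 𝒳 hdisj hO hΩ j b
        (by rcases hj with hj | hj <;> [left; right] <;> omega)) hm)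
    n k hn x hx

end Witt

end Literature.AlgebraicGeometry.Crystalline

end
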